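import Summits.AtomisticToContinuum.HydrodynamicLimit.Theorems.CollisionIsometryCLTAdaptedWeightCLTBHCoarsening
import Summits.AtomisticToContinuum.HydrodynamicLimit.Theorems.CollisionIsometryCLTAdaptedWeightCLTSAReynoldsStatics

/-!
# Equilibrium rung of `stub_reynoldsBH` (line `block-h-dissipation-closure`, crux stmt-AtomisticToContinuum-14868):
# the smeared Reynolds integrands of ONE CELL under independent Gaussian velocities

Support file (`--supports stmt-AtomisticToContinuum-14868`, anchor `bhReynoldsBH_gauss_anchor`) of the stub worker of
`stub_reynoldsBH`; second file of its EQUILIBRIUM RUNG (independent of the first, `…BHReynoldsBHPointwise`). At fixed positions `p`,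
block centre `x` and CELL CENTRE `x'`, under the product law `⊗ᵢ N(u, θ𝟙)` of the velocities (the local Gibbs
velocities given the positions, at constant profiles), with block ratios `qⱼ = φ_N(pⱼ − x)/W` and the convex CELL
SHARES `Pⱼ(x') = ψ_N(pⱼ − x')/Σₘ ψ_N(pₘ − x')` of the ψ-cell at `x'`:

* `ubarC_zipConfig_eq` — the smeared cell velocity is `ū_ψ(x') = u + Σⱼ Pⱼ(x') (vⱼ − u)` on a nonempty cell, so
  `ū_ψ(x') − ū_φ(x) = Σⱼ (Pⱼ(x') − qⱼ)(vⱼ − u)` and `vᵢ − ū_ψ(x') = (vᵢ − u) − Σⱼ Pⱼ(x') (vⱼ − u)`: the objects `g, d`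
  of `…SAReynoldsGauss` with CONSTANT rows `P k j = Pⱼ(x')`;
* `lintegral_cell_sq_le` — the conditional mean of the `x'`-integrand of `rtwoG`:
  `E_v (N+1)⁻¹ Σᵢ aᵢ bᵢ(x') |ū_ψ(x') − ū_φ(x)|² = c(x') · 3θ Σⱼ (Pⱼ(x') − qⱼ)² ≤ c(x') · 6θ (S(x') + w_max/W)`,
  `c(x') = (N+1)⁻¹ Σᵢ aᵢ bᵢ(x')`, `S(x') = Σⱼ Pⱼ(x')²` the SELF-SHARE of the ψ-cell (`cellShareG`), `Σ qⱼ² ≤ w_max/W`;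
* `lintegral_cell_env_le` — the conditional mean of the `x'`-integrand of `envG` is at most
  `(N+1)⁻¹ Σᵢ aᵢ bᵢ(x') (3 + 3 · 2¹⁶ m₁₆)` (`E|d|¹⁶, E|g|¹⁶ ≤ 2¹⁶ m₁₆`, `…SAReynoldsGauss`);
* the cell integrands are jointly measurable in `((w, x), x')` (for Tonelli in `(v, x')`, `…BHReynoldsBHZip`);
* the self-share is position-only, measurable in `x'`, in `[0, 1]`, and obeys the HEIGHT BOUND
  `(Σₘ ψ_N(pₘ − x')) · S(x') ≤ sup ψ_N` (`sum_mul_cellShareG_le`) — the smeared substitute for the packing lemma of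
  `…SAReynoldsPacking`: integrated over the torus it gives `(N+1)⁻¹ ∫ B S dx' ≤ C' (N+1)^{3γc − 1} → 0`, with no
  occupation statistics and no floor on `ψ_N`.
Empty cells (`Σₘ ψ_N(pₘ − x') = 0`) and empty blocks carry no weight: every integrand has the factor `aᵢ bᵢ(x')`.

References: H. Spohn, *Large Scale Dynamics of Interacting Particles* (1991), Part I §2.3 [Spohn1991].
-/

namespace Summit.AtomisticToContinuum.HydrodynamicLimit.Theorems.BlockHDissipation

open scoped BigOperators Topology Classical MeasureTheory ENNReal InnerProductSpace
open Filter Set MeasureTheory ProbabilityTheory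
open Literature.Analysis.FluidPDE Literature.Analysis.FluidPDE.Torus
open Summit.AtomisticToContinuum.HydrodynamicLimit.Theorems.ContactSourceDuhamel
open Summit.AtomisticToContinuum.HydrodynamicLimit.Theorems.ContactSourceDuhamel.TimeLocal
open Summit.AtomisticToContinuum.HydrodynamicLimit.Theorems.ContactBalance
open Summit.AtomisticToContinuum.HydrodynamicLimit.Theorems.SustainedAnisotropy
open Literature.MathematicalPhysics.KineticTheory (gaussMeasure zipConfig zipConfig_apply measurable_zipConfig)

noncomputable section

/-- The SELF-SHARE of the ψ-cell centred at `x'` for the positions `p`: `S(x') = Σⱼ (ψ_N(pⱼ − x')/Σₘ ψ_N(pₘ − x'))²`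
(junk `0` on an empty cell). -/
def cellShareG (N : ℕ) (ψ : ℕ → T3 → ℝ) (p : Fin (N + 1) → T3) (x' : T3) : ℝ :=
  ∑ j : Fin (N + 1), (ψ N (p j - x') / ∑ m : Fin (N + 1), ψ N (p m - x')) ^ 2

/-- The SMEARED SELF-SHARE of particle `i`: `cᵢ = ∫ ψ_N(pᵢ − x') S(x') dx'` (the `ψ`-average of the self-shares of the
cells containing `i`). -/
def smearShareG (N : ℕ) (ψ : ℕ → T3 → ℝ) (p : Fin (N + 1) → T3) (i : Fin (N + 1)) : ℝ :=
  ∫ x', ψ N (p i - x') * cellShareG N ψ p x'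

namespace ReynoldsBH

/-! ## Joint measurability of the cell integrands -/

section Meas

variable {N : ℕ} {φ ψ : ℕ → T3 → ℝ}

/-- The quadratic cell integrand is jointly measurable on `(Cfg × 𝕋³) × 𝕋³`. -/
theorem measurable_sq_integrand (hφc : Continuous (φ N)) (hψc : Continuous (ψ N)) :
    Measurable fun p : (Cfg N × T3) × T3 => ((N + 1 : ℕ) : ℝ)⁻¹ * ∑ i : Fin (N + 1),
      wgtC N φ p.1.1 p.1.2 i * (wgtC N ψ p.1.1 p.2 i * ‖ubarC N ψ p.1.1 p.2 - ubarC N φ p.1.1 p.1.2‖ ^ 2) := by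
  refine (Finset.measurable_sum _ fun i _ => ?_).const_mul _
  obtain ⟨h1, h2, h3, h4, -⟩ := Coarsening.measurable_blocks hφc hψc i
  exact h1.mul (h2.mul ((h3.sub h4).norm.pow_const 2))

/-- The envelope cell integrand is jointly measurable on `(Cfg × 𝕋³) × 𝕋³`. -/
theorem measurable_env_integrand (hφc : Continuous (φ N)) (hψc : Continuous (ψ N)) :
    Measurable fun p : (Cfg N × T3) × T3 => ((N + 1 : ℕ) : ℝ)⁻¹ * ∑ i : Fin (N + 1),
      wgtC N φ p.1.1 p.1.2 i * (wgtC N ψ p.1.1 p.2 i *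
        (3 + 2 * ‖(p.1.1 i).2 - ubarC N ψ p.1.1 p.2‖ ^ 16 + ‖ubarC N ψ p.1.1 p.2 - ubarC N φ p.1.1 p.1.2‖ ^ 16)) := by
  refine (Finset.measurable_sum _ fun i _ => ?_).const_mul _
  obtain ⟨h1, h2, h3, h4, h5⟩ := Coarsening.measurable_blocks hφc hψc i
  exact h1.mul (h2.mul ((measurable_const.add (((h5.sub h3).norm.pow_const 16).const_mul _)).add
    ((h3.sub h4).norm.pow_const 16)))

/-- `(v, x') ↦ ((zipConfig (p, v), x), x')` is measurable. -/
theorem measurable_zip_pair (p : Fin (N + 1) → T3) (x : T3) :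
    Measurable fun q : (Fin (N + 1) → V3) × T3 => ((zipConfig (p, q.1), x), q.2) :=
  ((measurable_zipConfig.comp (measurable_const.prodMk measurable_fst)).prodMk measurable_const).prodMk
    measurable_snd

/-- `v ↦ (zipConfig (p, v), x)` is measurable. -/
theorem measurable_zip_left (p : Fin (N + 1) → T3) (x : T3) :
    Measurable fun v : Fin (N + 1) → V3 => (zipConfig (p, v), x) :=
  (measurable_zipConfig.comp (measurable_const.prodMk measurable_id)).prodMk measurable_const

end Meas

/-! ## The self-share of a cell -/

section Share

variable {N : ℕ} {ψ : ℕ → T3 → ℝ} (p : Fin (N + 1) → T3)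

/-- `0 ≤ S(x')`. -/
theorem cellShareG_nonneg (x' : T3) : 0 ≤ cellShareG N ψ p x' :=
  Finset.sum_nonneg fun _ _ => sq_nonneg _

/-- `S(x') ≤ 1` (convex weights; `0` on an empty cell). -/
theorem cellShareG_le_one (hψ0 : ∀ y, 0 ≤ ψ N y) (x' : T3) : cellShareG N ψ p x' ≤ 1 := by
  unfold cellShareG
  by_cases hB : ∑ m, ψ N (p m - x') = 0
  · have hb : ∀ j, ψ N (p j - x') = 0 := fun j =>
      (Finset.sum_eq_zero_iff_of_nonneg fun m _ => hψ0 (p m - x')).1 hB j (Finset.mem_univ j)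
    simp [hb]
  · exact (EqRung.ratios_props (w := fun j => ψ N (p j - x')) (fun j => hψ0 _) hB
      (fun j => Finset.single_le_sum (fun m _ => hψ0 (p m - x')) (Finset.mem_univ j))).2.2.1

/-- THE HEIGHT BOUND: `(Σₘ ψ_N(pₘ − x')) · S(x') ≤ h` whenever `ψ_N ≤ h` (`B Σⱼ Pⱼ² ≤ B maxⱼ Pⱼ = maxⱼ bⱼ`). -/
theorem sum_mul_cellShareG_le (hψ0 : ∀ y, 0 ≤ ψ N y) {h : ℝ} (hψh : ∀ y, ψ N y ≤ h) (x' : T3) :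
    (∑ m, ψ N (p m - x')) * cellShareG N ψ p x' ≤ h := by
  have hh : 0 ≤ h := (hψ0 0).trans (hψh 0)
  unfold cellShareG
  by_cases hB : ∑ m, ψ N (p m - x') = 0
  · rw [hB, zero_mul]; exact hh
  · have hBpos : 0 < ∑ m, ψ N (p m - x') :=
      lt_of_le_of_ne (Finset.sum_nonneg fun m _ => hψ0 _) (Ne.symm hB)
    have h4 := (EqRung.ratios_props (w := fun j => ψ N (p j - x')) (fun j => hψ0 _) hB (fun j => hψh _)).2.2.2
    calc (∑ m, ψ N (p m - x')) * ∑ j, (ψ N (p j - x') / ∑ m, ψ N (p m - x')) ^ 2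
        ≤ (∑ m, ψ N (p m - x')) * (h / ∑ m, ψ N (p m - x')) := mul_le_mul_of_nonneg_left h4 hBpos.le
      _ = h := mul_div_cancel₀ h hB

/-- `S` is measurable in the cell centre (continuous cell kernel). -/
theorem measurable_cellShareG (hψc : Continuous (ψ N)) : Measurable (cellShareG N ψ p) := by
  unfold cellShareG
  refine Finset.measurable_sum _ fun j _ => ((hψc.measurable.comp (measurable_const.sub measurable_id)).div
    (Finset.measurable_sum _ fun m _ => hψc.measurable.comp (measurable_const.sub measurable_id))).pow_const 2

/-- `x' ↦ ψ_N(pᵢ − x') S(x')` is integrable (measurable, bounded by the height, on a probability space). -/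
theorem integrable_mul_cellShareG (hψc : Continuous (ψ N)) (hψ0 : ∀ y, 0 ≤ ψ N y) {h : ℝ} (hψh : ∀ y, ψ N y ≤ h)
    (i : Fin (N + 1)) : Integrable fun x' => ψ N (p i - x') * cellShareG N ψ p x' := by
  refine Integrable.of_bound (((hψc.measurable.comp (measurable_const.sub measurable_id)).mul
    (measurable_cellShareG p hψc)).aestronglyMeasurable) h (ae_of_all _ fun x' => ?_)
  rw [Real.norm_eq_abs, abs_of_nonneg (mul_nonneg (hψ0 _) (cellShareG_nonneg p x'))]
  calc ψ N (p i - x') * cellShareG N ψ p x' ≤ h * 1 :=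
        mul_le_mul (hψh _) (cellShareG_le_one p hψ0 x') (cellShareG_nonneg p x') ((hψ0 0).trans (hψh 0))
    _ = h := mul_one h

/-- `0 ≤ cᵢ`. -/
theorem smearShareG_nonneg (hψ0 : ∀ y, 0 ≤ ψ N y) (i : Fin (N + 1)) : 0 ≤ smearShareG N ψ p i :=
  integral_nonneg fun x' => mul_nonneg (hψ0 _) (cellShareG_nonneg p x')

/-- THE SMEARED SELF-SHARES ARE SMALL IN THE MEAN: `Σᵢ cᵢ = ∫ (Σᵢ ψ_N(pᵢ − x')) S(x') dx' ≤ h` (height bound, unit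
volume of the torus), for EVERY position configuration. -/
theorem sum_smearShareG_le (hψc : Continuous (ψ N)) (hψ0 : ∀ y, 0 ≤ ψ N y) {h : ℝ} (hψh : ∀ y, ψ N y ≤ h) :
    ∑ i, smearShareG N ψ p i ≤ h := by
  unfold smearShareG
  rw [← integral_finsetSum _ fun i _ => integrable_mul_cellShareG p hψc hψ0 hψh i]
  have hle : ∀ x', ∑ i, ψ N (p i - x') * cellShareG N ψ p x' ≤ h := fun x' => by
    rw [← Finset.sum_mul]; exact sum_mul_cellShareG_le p hψ0 hψh x'
  calc ∫ x', ∑ i, ψ N (p i - x') * cellShareG N ψ p x' ≤ ∫ _x' : T3, h :=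
        integral_mono (integrable_finsetSum _ fun i _ => integrable_mul_cellShareG p hψc hψ0 hψh i)
          (integrable_const h) hle
    _ = h := by rw [integral_const, probReal_univ, one_smul]

/-- A cell integrand with a bounded measurable test is integrable in the cell centre:
`x' ↦ ψ_N(pᵢ − x') (α S(x') + β)`. -/
theorem integrable_cell_test (hψc : Continuous (ψ N)) (hψ0 : ∀ y, 0 ≤ ψ N y) {h : ℝ} (hψh : ∀ y, ψ N y ≤ h)
    (i : Fin (N + 1)) (α β : ℝ) :
    Integrable fun x' => ψ N (p i - x') * (α * cellShareG N ψ p x' + β) := by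
  have h1 : Integrable fun x' => α * (ψ N (p i - x') * cellShareG N ψ p x') + β * ψ N (p i - x') :=
    ((integrable_mul_cellShareG p hψc hψ0 hψh i).const_mul α).add
      ((PastDamping.integrable_of_continuous_T3 (hψc.comp (continuous_const.sub continuous_id))).const_mul β)
  exact h1.congr (ae_of_all _ fun x' => by ring)

/-- `∫ ψ_N(pᵢ − x') (α S(x') + β) dx' = α cᵢ + β`. -/
theorem integral_cell_test (hψc : Continuous (ψ N)) (hψ0 : ∀ y, 0 ≤ ψ N y) (hψ1 : ∫ y, ψ N y = 1) {h : ℝ}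
    (hψh : ∀ y, ψ N y ≤ h) (i : Fin (N + 1)) (α β : ℝ) :
    ∫ x', ψ N (p i - x') * (α * cellShareG N ψ p x' + β) = α * smearShareG N ψ p i + β := by
  have hA : Integrable fun x' => α * (ψ N (p i - x') * cellShareG N ψ p x') :=
    (integrable_mul_cellShareG p hψc hψ0 hψh i).const_mul α
  have hB : Integrable fun x' => β * ψ N (p i - x') :=
    (PastDamping.integrable_of_continuous_T3 (f := fun x' => ψ N (p i - x'))
      (hψc.comp (continuous_const.sub continuous_id))).const_mul β
  calc ∫ x', ψ N (p i - x') * (α * cellShareG N ψ p x' + β)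
      = ∫ x', (α * (ψ N (p i - x') * cellShareG N ψ p x') + β * ψ N (p i - x')) :=
        integral_congr_ae (ae_of_all _ fun x' => by ring)
    _ = α * smearShareG N ψ p i + β := by
        rw [integral_add hA hB, integral_const_mul, integral_const_mul,
          PastDamping.integral_comp_sub_left (ψ N) (p i), hψ1, mul_one]
        rfl

end Share

/-! ## One cell under independent Gaussian velocities -/

section Cell

variable (u : V3) {θ : ℝ} {N : ℕ} {φ ψ : ℕ → T3 → ℝ} (p : Fin (N + 1) → T3) (x : T3)

/-- `0 ≤ 2¹⁶ m₁₆` (the sixteenth Gaussian moment). -/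
theorem m16_nonneg : 0 ≤ 2 ^ 16 * ∫ w, ‖w - u‖ ^ 16 ∂gaussMeasure u θ :=
  mul_nonneg (by positivity) (EqRung.integral_norm_sub_pow_nonneg u θ 16)

/-- DICTIONARY: on a nonempty block (or cell), the block (cell) velocity of a zipped configuration is
`u + Σⱼ (wⱼ/W) (vⱼ − u)`. -/
theorem ubarC_zipConfig_eq (φ : ℕ → T3 → ℝ) (p : Fin (N + 1) → T3) (x : T3) (u : V3)
    (hW : ∑ j, φ N (p j - x) ≠ 0) (v : Fin (N + 1) → V3) :
    ubarC N φ (zipConfig (p, v)) x = u + ∑ j, (φ N (p j - x) / ∑ m, φ N (p m - x)) • (v j - u) := by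
  rw [Pointwise.ubarC_eq]
  simp_rw [EqRung.wgtC_zipConfig]
  simp only [zipConfig_apply]
  exact EqRung.inv_smul_sum_smul_eq u hW v

/-- Factoring a test that does not depend on the particle: `(N+1)⁻¹ Σᵢ aᵢ (bᵢ F) = ((N+1)⁻¹ Σᵢ aᵢ bᵢ) F`. -/
theorem avg_mul_mul_const (a b : Fin (N + 1) → ℝ) (F : ℝ) :
    ((N + 1 : ℕ) : ℝ)⁻¹ * ∑ i, a i * (b i * F) = (((N + 1 : ℕ) : ℝ)⁻¹ * ∑ i, a i * b i) * F := by
  rw [mul_assoc, Finset.sum_mul]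
  exact congrArg _ (Finset.sum_congr rfl fun i _ => by ring)

/-- **THE QUADRATIC CELL INTEGRAND.** Under `⊗ N(u, θ𝟙)`, for nonnegative kernels with `φ_N ≤ w_max`:
`E_v (N+1)⁻¹ Σᵢ aᵢ bᵢ(x') |ū_ψ(x') − ū_φ(x)|² ≤ (N+1)⁻¹ Σᵢ aᵢ bᵢ(x') · 6θ (S(x') + w_max/W)`. -/
theorem lintegral_cell_sq_le (hθ : 0 < θ) (hφ0 : ∀ y, 0 ≤ φ N y) {wmax : ℝ} (hφC : ∀ y, φ N y ≤ wmax)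
    (hψ0 : ∀ y, 0 ≤ ψ N y) (x' : T3) :
    ∫⁻ v, ENNReal.ofReal (((N + 1 : ℕ) : ℝ)⁻¹ * ∑ i, wgtC N φ (zipConfig (p, v)) x i *
        (wgtC N ψ (zipConfig (p, v)) x' i *
          ‖ubarC N ψ (zipConfig (p, v)) x' - ubarC N φ (zipConfig (p, v)) x‖ ^ 2))
        ∂(Measure.pi fun _ : Fin (N + 1) => gaussMeasure u θ) ≤
      ENNReal.ofReal (((N + 1 : ℕ) : ℝ)⁻¹ * ∑ i, φ N (p i - x) * (ψ N (p i - x') *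
        (6 * θ * (cellShareG N ψ p x' + wmax / ∑ j, φ N (p j - x))))) := by
  simp_rw [EqRung.wgtC_zipConfig, avg_mul_mul_const]
  set c := ((N + 1 : ℕ) : ℝ)⁻¹ * ∑ i, φ N (p i - x) * ψ N (p i - x') with hc
  have hc0 : 0 ≤ c := mul_nonneg (by positivity) (Finset.sum_nonneg fun i _ => mul_nonneg (hφ0 _) (hψ0 _))
  by_cases hW0 : ∑ j, φ N (p j - x) = 0
  · have ha : ∀ i, φ N (p i - x) = 0 := fun i =>
      (Finset.sum_eq_zero_iff_of_nonneg fun j _ => hφ0 (p j - x)).1 hW0 i (Finset.mem_univ i)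
    have hc00 : c = 0 := by rw [hc]; simp [ha]
    simp [hc00]
  by_cases hB0 : ∑ m, ψ N (p m - x') = 0
  · have hb : ∀ i, ψ N (p i - x') = 0 := fun i =>
      (Finset.sum_eq_zero_iff_of_nonneg fun m _ => hψ0 (p m - x')).1 hB0 i (Finset.mem_univ i)
    have hc00 : c = 0 := by rw [hc]; simp [hb]
    simp [hc00]
  -- a nonempty block and a nonempty cell: the sub-block velocity is `Σⱼ (Pⱼ − qⱼ)(vⱼ − u)`
  set q : Fin (N + 1) → ℝ := fun j => φ N (p j - x) / ∑ m, φ N (p m - x) with hq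
  set P : Fin (N + 1) → ℝ := fun j => ψ N (p j - x') / ∑ m, ψ N (p m - x') with hP
  set g : (Fin (N + 1) → V3) → V3 := fun v => ∑ j, (P j - q j) • (v j - u) with hg
  have hδ : ∀ v, ubarC N ψ (zipConfig (p, v)) x' - ubarC N φ (zipConfig (p, v)) x = g v := fun v => by
    rw [ubarC_zipConfig_eq ψ p x' u hB0 v, ubarC_zipConfig_eq φ p x u hW0 v, hg, add_sub_add_left_eq_sub,
      ← Finset.sum_sub_distrib]
    exact Finset.sum_congr rfl fun j _ => by rw [sub_smul]
  simp_rw [hδ, ENNReal.ofReal_mul hc0]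
  rw [lintegral_const_mul' _ _ ENNReal.ofReal_ne_top, EqRung.lintegral_norm_eta_sq u θ (fun j => P j - q j) g hg hθ]
  refine mul_le_mul_right (ENNReal.ofReal_le_ofReal ?_) _
  obtain ⟨-, -, -, hq2⟩ := EqRung.ratios_props (w := fun i => φ N (p i - x)) (fun i => hφ0 _) hW0 (fun i => hφC _)
  have hq2' : ∑ j, q j ^ 2 ≤ wmax / ∑ j, φ N (p j - x) := hq2
  have hS : cellShareG N ψ p x' = ∑ j, P j ^ 2 := rfl
  calc 3 * θ * ∑ j, (P j - q j) ^ 2 ≤ 3 * θ * ∑ j, (2 * P j ^ 2 + 2 * q j ^ 2) :=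
        mul_le_mul_of_nonneg_left (Finset.sum_le_sum fun j _ => by nlinarith [sq_nonneg (P j + q j)])
          (by positivity)
    _ = 6 * θ * (∑ j, P j ^ 2 + ∑ j, q j ^ 2) := by
        rw [Finset.sum_add_distrib, ← Finset.mul_sum, ← Finset.mul_sum]; ring
    _ ≤ 6 * θ * (cellShareG N ψ p x' + wmax / ∑ j, φ N (p j - x)) := by
        rw [hS]
        exact mul_le_mul_of_nonneg_left (add_le_add le_rfl hq2') (by positivity)

/-- **THE ENVELOPE CELL INTEGRAND.** Under `⊗ N(u, θ𝟙)`, for nonnegative kernels: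
`E_v (N+1)⁻¹ Σᵢ aᵢ bᵢ(x') (3 + 2|vᵢ − ū_ψ(x')|¹⁶ + |ū_ψ(x') − ū_φ(x)|¹⁶) ≤ (N+1)⁻¹ Σᵢ aᵢ bᵢ(x') (3 + 3 · 2¹⁶ m₁₆)`. -/
theorem lintegral_cell_env_le (hφ0 : ∀ y, 0 ≤ φ N y) (hψ0 : ∀ y, 0 ≤ ψ N y) (x' : T3) :
    ∫⁻ v, ENNReal.ofReal (((N + 1 : ℕ) : ℝ)⁻¹ * ∑ i, wgtC N φ (zipConfig (p, v)) x i *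
        (wgtC N ψ (zipConfig (p, v)) x' i *
          (3 + 2 * ‖(zipConfig (p, v) i).2 - ubarC N ψ (zipConfig (p, v)) x'‖ ^ 16 +
            ‖ubarC N ψ (zipConfig (p, v)) x' - ubarC N φ (zipConfig (p, v)) x‖ ^ 16)))
        ∂(Measure.pi fun _ : Fin (N + 1) => gaussMeasure u θ) ≤
      ENNReal.ofReal (((N + 1 : ℕ) : ℝ)⁻¹ * ∑ i, φ N (p i - x) * (ψ N (p i - x') *
        (3 + 3 * (2 ^ 16 * ∫ w, ‖w - u‖ ^ 16 ∂gaussMeasure u θ)))) := by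
  set μ := Measure.pi fun _ : Fin (N + 1) => gaussMeasure u θ with hμ
  haveI : IsProbabilityMeasure μ := by rw [hμ]; infer_instance
  obtain ⟨M16, hM16eq⟩ : ∃ M : ℝ, M = 2 ^ 16 * ∫ w, ‖w - u‖ ^ 16 ∂gaussMeasure u θ := ⟨_, rfl⟩
  have hM16 : 0 ≤ M16 := by rw [hM16eq]; exact mul_nonneg (by positivity) (EqRung.integral_norm_sub_pow_nonneg u θ 16)
  rw [← hM16eq]
  have hn : (0 : ℝ) ≤ ((N + 1 : ℕ) : ℝ)⁻¹ := by positivity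
  simp_rw [EqRung.wgtC_zipConfig]
  simp only [zipConfig_apply]
  by_cases hW0 : ∑ j, φ N (p j - x) = 0
  · have ha : ∀ i, φ N (p i - x) = 0 := fun i =>
      (Finset.sum_eq_zero_iff_of_nonneg fun j _ => hφ0 (p j - x)).1 hW0 i (Finset.mem_univ i)
    simp [ha]
  by_cases hB0 : ∑ m, ψ N (p m - x') = 0
  · have hb : ∀ i, ψ N (p i - x') = 0 := fun i =>
      (Finset.sum_eq_zero_iff_of_nonneg fun m _ => hψ0 (p m - x')).1 hB0 i (Finset.mem_univ i)
    simp [hb]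
  -- a nonempty block and a nonempty cell: the objects `g, d` of `…SAReynoldsGauss` with constant rows
  set q : Fin (N + 1) → ℝ := fun j => φ N (p j - x) / ∑ m, φ N (p m - x) with hq
  set P : Fin (N + 1) → Fin (N + 1) → ℝ := fun _ j => ψ N (p j - x') / ∑ m, ψ N (p m - x') with hP
  set g : Fin (N + 1) → (Fin (N + 1) → V3) → V3 := fun k v => ∑ j, (P k j - q j) • (v j - u) with hg
  set d : Fin (N + 1) → (Fin (N + 1) → V3) → V3 := fun k v => (v k - u) - ∑ j, P k j • (v j - u) with hd
  obtain ⟨hq0, hq1, -, -⟩ := EqRung.ratios_props (w := fun i => φ N (p i - x)) (fun i => hφ0 _) hW0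
    (fun i => Finset.single_le_sum (fun j _ => hφ0 (p j - x)) (Finset.mem_univ i))
  have hP0 : ∀ k j, 0 ≤ P k j := fun k j => div_nonneg (hψ0 _) (Finset.sum_nonneg fun m _ => hψ0 _)
  have hP1 : ∀ k, ∑ j, P k j = 1 := fun k => by
    rw [hP]
    dsimp only
    rw [← Finset.sum_div, div_self hB0]
  have hgi : ∀ v i, ubarC N ψ (zipConfig (p, v)) x' - ubarC N φ (zipConfig (p, v)) x = g i v := fun v i => by
    rw [ubarC_zipConfig_eq ψ p x' u hB0 v, ubarC_zipConfig_eq φ p x u hW0 v, hg, add_sub_add_left_eq_sub,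
      ← Finset.sum_sub_distrib]
    exact Finset.sum_congr rfl fun j _ => by rw [sub_smul]
  have hdi : ∀ v i, v i - ubarC N ψ (zipConfig (p, v)) x' = d i v := fun v i => by
    rw [ubarC_zipConfig_eq ψ p x' u hB0 v, hd]
    exact sub_add_eq_sub_sub _ _ _
  have hgk : ∀ k, Continuous (g k) := fun k => by rw [hg]; fun_prop
  have hdk : ∀ k, Continuous (d k) := fun k => by rw [hd]; fun_prop
  have mg : ∀ k, Measurable fun v : Fin (N + 1) → V3 => ENNReal.ofReal (‖g k v‖ ^ 16) :=
    fun k => ((hgk k).norm.pow 16).measurable.ennreal_ofReal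
  have md : ∀ k, Measurable fun v : Fin (N + 1) → V3 => ENNReal.ofReal (‖d k v‖ ^ 16) :=
    fun k => ((hdk k).norm.pow 16).measurable.ennreal_ofReal
  have Eg : ∀ k, ∫⁻ v, ENNReal.ofReal (‖g k v‖ ^ 16) ∂μ ≤ ENNReal.ofReal M16 := fun k => by
    rw [hM16eq]; exact Reynolds.lintegral_norm_g_pow_le u θ q P g hq0 hq1 hP0 hP1 hg k (by norm_num)
  have Ed : ∀ k, ∫⁻ v, ENNReal.ofReal (‖d k v‖ ^ 16) ∂μ ≤ ENNReal.ofReal M16 := fun k => by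
    rw [hM16eq]; exact Reynolds.lintegral_norm_d_pow_le u θ P d hP0 hP1 hd k (by norm_num)
  -- rewrite the integrand particle by particle
  have hpt : ∀ v : Fin (N + 1) → V3, ENNReal.ofReal (((N + 1 : ℕ) : ℝ)⁻¹ * ∑ i, φ N (p i - x) *
      (ψ N (p i - x') * (3 + 2 * ‖v i - ubarC N ψ (zipConfig (p, v)) x'‖ ^ 16 +
        ‖ubarC N ψ (zipConfig (p, v)) x' - ubarC N φ (zipConfig (p, v)) x‖ ^ 16))) =
      ∑ i, ENNReal.ofReal (((N + 1 : ℕ) : ℝ)⁻¹ * (φ N (p i - x) * ψ N (p i - x'))) *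
        (3 + 2 * ENNReal.ofReal (‖d i v‖ ^ 16) + ENNReal.ofReal (‖g i v‖ ^ 16)) := by
    intro v
    rw [Finset.mul_sum, ENNReal.ofReal_sum_of_nonneg fun i _ =>
      mul_nonneg hn (mul_nonneg (hφ0 _) (mul_nonneg (hψ0 _) (by positivity)))]
    refine Finset.sum_congr rfl fun i _ => ?_
    rw [hdi v i, hgi v i, show ((N + 1 : ℕ) : ℝ)⁻¹ * (φ N (p i - x) * (ψ N (p i - x') *
        (3 + 2 * ‖d i v‖ ^ 16 + ‖g i v‖ ^ 16))) = ((N + 1 : ℕ) : ℝ)⁻¹ * (φ N (p i - x) * ψ N (p i - x')) *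
        (3 + 2 * ‖d i v‖ ^ 16 + ‖g i v‖ ^ 16) by ring,
      ENNReal.ofReal_mul (mul_nonneg hn (mul_nonneg (hφ0 _) (hψ0 _))),
      ENNReal.ofReal_add (by positivity) (by positivity), ENNReal.ofReal_add (by positivity) (by positivity),
      ENNReal.ofReal_mul zero_le_two, ENNReal.ofReal_ofNat, ENNReal.ofReal_ofNat]
  simp_rw [hpt]
  have hm1 : ∀ i, Measurable fun v : Fin (N + 1) → V3 => (3 : ℝ≥0∞) + 2 * ENNReal.ofReal (‖d i v‖ ^ 16) :=
    fun i => measurable_const.add ((md i).const_mul _)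
  have hmi : ∀ i, Measurable fun v : Fin (N + 1) → V3 =>
      ENNReal.ofReal (((N + 1 : ℕ) : ℝ)⁻¹ * (φ N (p i - x) * ψ N (p i - x'))) *
        (3 + 2 * ENNReal.ofReal (‖d i v‖ ^ 16) + ENNReal.ofReal (‖g i v‖ ^ 16)) := fun i =>
    ((hm1 i).add (mg i)).const_mul _
  rw [lintegral_finsetSum _ fun i _ => hmi i]
  have e3 : (3 : ℝ≥0∞) + 2 * ENNReal.ofReal M16 + ENNReal.ofReal M16 = ENNReal.ofReal (3 + 3 * M16) := by
    rw [ENNReal.ofReal_add zero_le_three (mul_nonneg zero_le_three hM16), ENNReal.ofReal_mul zero_le_three,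
      ENNReal.ofReal_ofNat]
    ring
  calc ∑ i, ∫⁻ v, ENNReal.ofReal (((N + 1 : ℕ) : ℝ)⁻¹ * (φ N (p i - x) * ψ N (p i - x'))) *
        (3 + 2 * ENNReal.ofReal (‖d i v‖ ^ 16) + ENNReal.ofReal (‖g i v‖ ^ 16)) ∂μ
      = ∑ i, ENNReal.ofReal (((N + 1 : ℕ) : ℝ)⁻¹ * (φ N (p i - x) * ψ N (p i - x'))) *
          (3 + 2 * ∫⁻ v, ENNReal.ofReal (‖d i v‖ ^ 16) ∂μ + ∫⁻ v, ENNReal.ofReal (‖g i v‖ ^ 16) ∂μ) := by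
        refine Finset.sum_congr rfl fun i _ => ?_
        rw [lintegral_const_mul' _ _ ENNReal.ofReal_ne_top, lintegral_add_left (hm1 i),
          lintegral_add_left measurable_const, lintegral_const, measure_univ, mul_one,
          lintegral_const_mul' _ _ ENNReal.ofNat_ne_top]
    _ ≤ ∑ i, ENNReal.ofReal (((N + 1 : ℕ) : ℝ)⁻¹ * (φ N (p i - x) * ψ N (p i - x'))) *
          (3 + 2 * ENNReal.ofReal M16 + ENNReal.ofReal M16) :=
        Finset.sum_le_sum fun i _ => mul_le_mul_right
          (add_le_add (add_le_add le_rfl (mul_le_mul_right (Ed i) _)) (Eg i)) _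
    _ = ENNReal.ofReal (((N + 1 : ℕ) : ℝ)⁻¹ * ∑ i, φ N (p i - x) * (ψ N (p i - x') * (3 + 3 * M16))) := by
        have h33 : (0 : ℝ) ≤ 3 + 3 * M16 := by linarith
        rw [e3, Finset.mul_sum, ENNReal.ofReal_sum_of_nonneg fun i _ =>
          mul_nonneg hn (mul_nonneg (hφ0 _) (mul_nonneg (hψ0 _) h33))]
        refine Finset.sum_congr rfl fun i _ => ?_
        rw [← ENNReal.ofReal_mul (mul_nonneg hn (mul_nonneg (hφ0 _) (hψ0 _)))]
        congr 1
        ring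

end Cell

end ReynoldsBH

/-- Registered anchor of this helper file (`--supports stmt-AtomisticToContinuum-14868`): the HEIGHT BOUND of the smeared
self-shares, `Σᵢ ∫ ψ_N(pᵢ − x') S(x') dx' ≤ sup ψ_N` for every position configuration
(`ReynoldsBH.sum_smearShareG_le`). -/
theorem bhReynoldsBH_gauss_anchor : ∀ (N : ℕ) (ψ : ℕ → T3 → ℝ) (p : Fin (N + 1) → T3) (h : ℝ), Continuous (ψ N) → (∀ y, 0 ≤ ψ N y) → (∀ y, ψ N y ≤ h) → ∑ i, smearShareG N ψ p i ≤ h :=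
  fun _ _ p _ hψc hψ0 hψh => ReynoldsBH.sum_smearShareG_le p hψc hψ0 hψh

end

end Summit.AtomisticToContinuum.HydrodynamicLimit.Theorems.BlockHDissipation
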